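import Mathlib
import HarnessLib
import Literature.Analysis.ValidatedNumerics.MultiPrecisionInterval
import Literature.MathematicalPhysics.QuantumLattice.HubbardFermiRadiusSmooth
import Summits.HubbardSuperconductivity.HubbardSuperconductivity.Theorems.KLProgrammeFreeBandJetAlgebra
import Summits.HubbardSuperconductivity.HubbardSuperconductivity.Theorems.KLProgrammeFreeBandJetCheck

/-!
# Route `KLProgramme` — ENGINE crux `KLRegimeEngineV17F2` (stmt-HubbardSuperconductivity-20437), row (C) `stub_twoLeg_curvature`,
# producer hypothesis `hcertA : KlwjCertA` — KLWJ-INKERNEL part 2b: SOUNDNESS OF THE BOX CHECKER, I (programs and interpretations)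
# (cell gate-hubbard-kl, seat hubbard-kl-k3c5-p1 g21; docket «KLWJ-INKERNEL-ROUTE» (p1b g19 memo 5340b98f1348eb46); 0 kit)

Sequel of `…FreeBandJetCheck` (the kernel-executable checker).  What a passing certificate MEANS:
* §1 relational parametricity of straight-line programs: if two interpretations `G : Alg α`, `H : Alg β` are related by `R`
  (`Alg.Hom R G H`: atoms, constants, default related; the operations preserve `R`) then every output register is related
  (`Alg.Hom.out`; register files related node-wise, `Regs.Rel`, preserved by `getD`/`push` — no index arithmetic is needed);
* §2 the two instances: FREE → REAL (`out_treeAlg_eval`: the real run computes the value `⟦treeAlg.out p r⟧_A` of the term held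
  by the free run) and REAL → INTERVAL (`mem_out_ivAlg`: if the atoms and `W` are enclosed, every `some I` output encloses the real
  output) — the inclusion theorems are the tree's (`NumericsMP.MI.mem_add/mem_mul/mem_neg/mem_divPos/mem_ofInt`);
  the reading lemma `abs_le_of_bddAbs`.
The box side (trigonometric hulls, `boxAtoms`, the leaf checks and `checkCert_sound`) is part II, `…FreeBandJetCheckSoundBox`.
Everything generic in the program, the table, the window and the parameters; nothing here asserts any table entry, row (C), any stub
of 20437, K3, U₀, the window, a margin or superconductivity in the Hubbard model.
References: R. E. Moore, *Interval Analysis* (1966), Ch. 3–4 (inclusion isotonicity; the natural interval extension) [folklore].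
-/

noncomputable section

namespace Summit.HubbardSuperconductivity.HubbardSuperconductivity.Theorems.FreeBandJets

set_option linter.dupNamespace false -- summit = problem name (single-conjunct summit), D-0017

open Real Set Literature.Analysis.ValidatedNumerics.NumericsMP Literature.MathematicalPhysics.QuantumLattice

/-! ## §1 Relational parametricity of straight-line programs -/

namespace Regs

variable {α β : Type} (R : α → β → Prop)

/-- Two register files of the same shape with node-wise related contents. -/
inductive Rel : Regs α → Regs β → Prop
  /-- empty files are related -/
  | nil : Rel nil nil
  /-- nodes with related contents and related subtrees are related -/
  | node {x : α} {y : β} {l r : Regs α} {l' r' : Regs β} : R x y → Rel l l' → Rel r r' → Rel (node x l r) (node y l' r')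

variable {R}

/-- Related files have related registers. -/
theorem Rel.getD {d : α} {d' : β} (hd : R d d') {t : Regs α} {t' : Regs β} (h : Rel R t t') :
    ∀ i : ℕ, R (t.getD d i) (t'.getD d' i) := by
  induction h with
  | nil => intro i; simpa [Regs.getD] using hd
  | node hxy _ _ ihl ihr =>
      intro i
      simp only [Regs.getD]
      split
      · exact hxy
      split
      · exact ihl _
      · exact ihr _

/-- Pushing related values keeps files related. -/
theorem Rel.push {t : Regs α} {t' : Regs β} (h : Rel R t t') {x : α} {y : β} (hxy : R x y) :
    ∀ n : ℕ, Rel R (t.push n x) (t'.push n y) := by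
  induction h with
  | nil => intro n; exact Rel.node hxy Rel.nil Rel.nil
  | node hab hl hr ihl ihr =>
      intro n
      simp only [Regs.push]
      split
      · exact Rel.node hab (ihl _) hr
      · exact Rel.node hab hl (ihr _)

end Regs

namespace Alg

variable {α β : Type}

/-- Two interpretations related by `R`: atoms, constants and defaults are related and the operations preserve `R`. -/
structure Hom (R : α → β → Prop) (G : Alg α) (H : Alg β) : Prop where
  /-- atoms -/
  atom : ∀ i, R (G.atom i) (H.atom i)
  /-- constants -/
  const : ∀ z, R (G.const z) (H.const z)
  /-- sums -/
  add : ∀ {x y x' y'}, R x x' → R y y' → R (G.add x y) (H.add x' y')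
  /-- products -/
  mul : ∀ {x y x' y'}, R x x' → R y y' → R (G.mul x y) (H.mul x' y')
  /-- negations -/
  neg : ∀ {x x'}, R x x' → R (G.neg x) (H.neg x')
  /-- divisions by `Wⁿ` -/
  divW : ∀ {x x'} (n : ℕ), R x x' → R (G.divW x n) (H.divW x' n)
  /-- defaults -/
  dflt : R G.dflt H.dflt

variable {R : α → β → Prop} {G : Alg α} {H : Alg β} (hGH : Hom R G H)
include hGH

/-- Related register files execute an instruction to related values. -/
theorem Hom.exec {s : Regs α} {s' : Regs β} (h : Regs.Rel R s s') (ins : Ins) : R (G.exec s ins) (H.exec s' ins) := by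
  cases ins with
  | atom i => exact hGH.atom i
  | const z => exact hGH.const z
  | add a b => exact hGH.add (h.getD hGH.dflt a) (h.getD hGH.dflt b)
  | mul a b => exact hGH.mul (h.getD hGH.dflt a) (h.getD hGH.dflt b)
  | neg a => exact hGH.neg (h.getD hGH.dflt a)
  | divW a n => exact hGH.divW n (h.getD hGH.dflt a)

/-- Related register files stay related along a run. -/
theorem Hom.run : ∀ (p : List Ins) {s : Regs α} {s' : Regs β}, Regs.Rel R s s' → ∀ n : ℕ, Regs.Rel R (G.run p s n) (H.run p s' n)
  | [], _, _, h, _ => by simpa [Alg.run] using h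
  | ins :: p, _, _, h, n => by
      simp only [Alg.run]
      exact Hom.run p (h.push (hGH.exec h ins) n) (n + 1)

/-- **Relational parametricity**: related interpretations give related outputs. [folklore] -/
theorem Hom.out (p : List Ins) (r : ℕ) : R (G.out p r) (H.out p r) :=
  (hGH.run p Regs.Rel.nil 0).getD hGH.dflt r

end Alg

/-! ## §2 The free, real and interval interpretations -/

/-- **FREE → REAL**: the real run computes the value of the term held by the free run. -/
theorem out_treeAlg_eval (A : ℕ → ℝ) (p : List Ins) (r : ℕ) : (treeAlg.out p r).eval A = (realAlg A).out p r := by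
  have hGH : Alg.Hom (fun e x => e.eval A = x) treeAlg (realAlg A) :=
    { atom := fun i => by simp [treeAlg, realAlg]
      const := fun z => by simp [treeAlg, realAlg]
      add := fun h1 h2 => by simp [treeAlg, realAlg, h1, h2]
      mul := fun h1 h2 => by simp [treeAlg, realAlg, h1, h2]
      neg := fun h1 => by simp [treeAlg, realAlg, h1]
      divW := fun n h1 => by simp [treeAlg, realAlg, h1]
      dflt := by simp [treeAlg, realAlg] }
  exact hGH.out p r

/-- The enclosure relation between a real and an optional interval (`none` encloses everything). -/
def EnclOpt (S : ℕ) (x : ℝ) (o : Option MI) : Prop := ∀ I, o = some I → MI.mem S x I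

/-- `n`-fold division by `W` is enclosed. -/
theorem enclOpt_divWI {S : ℕ} (hS : 0 < S) {W : MI} {w : ℝ} (hw : MI.mem S w W) {x : ℝ} {o : Option MI}
    (hx : EnclOpt S x o) : ∀ n : ℕ, EnclOpt S (x / w ^ n) (divWI S W o n)
  | 0 => by simpa [divWI] using hx
  | n + 1 => by
      intro I hI
      simp only [divWI] at hI
      cases hJ : divWI S W o n with
      | none => simp [hJ] at hI
      | some J =>
          rw [hJ] at hI
          simp only [Option.bind_some] at hI
          have hxJ := enclOpt_divWI hS hw hx n J hJ
          have := MI.mem_divPos hS hI hxJ hw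
          simpa [pow_succ, div_div] using this

/-- **REAL → INTERVAL**: if the atoms and the radial slope are enclosed, every interval output encloses the real output.
[folklore] -/
theorem mem_out_ivAlg {S : ℕ} (hS : 0 < S) {A : ℕ → ℝ} {As : ℕ → MI} (hA : ∀ i, MI.mem S (A i) (As i)) {W : MI}
    (hW : MI.mem S (JE.wval A) W) (p : List Ins) (r : ℕ) {I : MI} (h : (ivAlg S As W).out p r = some I) :
    MI.mem S ((realAlg A).out p r) I := by
  have hGH : Alg.Hom (fun x o => EnclOpt S x o) (realAlg A) (ivAlg S As W) :=
    { atom := fun i J hJ => by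
        simp only [ivAlg, Option.some.injEq] at hJ
        subst hJ; exact hA i
      const := fun z J hJ => by
        simp only [ivAlg, Option.some.injEq] at hJ
        subst hJ; exact MI.mem_ofInt S z
      add := fun {x y x' y'} h1 h2 J hJ => by
        cases x' with
        | none => simp [ivAlg] at hJ
        | some I1 =>
            cases y' with
            | none => simp [ivAlg] at hJ
            | some I2 =>
                simp only [ivAlg, Option.bind_some, Option.some.injEq] at hJ
                subst hJ
                exact MI.mem_add (h1 I1 rfl) (h2 I2 rfl)
      mul := fun {x y x' y'} h1 h2 J hJ => by
        cases x' with
        | none => simp [ivAlg] at hJ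
        | some I1 =>
            cases y' with
            | none => simp [ivAlg] at hJ
            | some I2 =>
                simp only [ivAlg, Option.bind_some, Option.some.injEq] at hJ
                subst hJ
                exact MI.mem_mul hS (h1 I1 rfl) (h2 I2 rfl)
      neg := fun {x x'} h1 J hJ => by
        cases x' with
        | none => simp [ivAlg] at hJ
        | some I1 =>
            simp only [ivAlg, Option.bind_some, Option.some.injEq] at hJ
            subst hJ
            exact MI.mem_neg (h1 I1 rfl)
      divW := fun {x x'} n h1 => by
        simpa [ivAlg, realAlg] using enclOpt_divWI hS hW h1 n
      dflt := fun J hJ => by simp [ivAlg] at hJ }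
  exact hGH.out p r I h

/-- **FREE → INTERVAL**: a `some I` output of the interval run encloses the value of the free run's term. -/
theorem mem_eval_out {S : ℕ} (hS : 0 < S) {A : ℕ → ℝ} {As : ℕ → MI} (hA : ∀ i, MI.mem S (A i) (As i)) {W : MI}
    (hW : MI.mem S (JE.wval A) W) (p : List Ins) (r : ℕ) {I : MI} (h : (ivAlg S As W).out p r = some I) :
    MI.mem S ((treeAlg.out p r).eval A) I := by
  rw [out_treeAlg_eval]; exact mem_out_ivAlg hS hA hW p r h

/-- Reading `|x| ≤ B` off `bddAbs`. -/
theorem abs_le_of_bddAbs {S : ℕ} (hS : 0 < S) {x : ℝ} {o : Option MI} (hx : EnclOpt S x o) {B : ℚ}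
    (h : bddAbs S o B = true) : |x| ≤ (B : ℝ) := by
  cases o with
  | none => simp [bddAbs] at h
  | some I =>
      simp only [bddAbs, decide_eq_true_eq] at h
      have hm := hx I rfl
      have h1 := MI.abs_le_absHi hm
      have hSr : (0 : ℝ) < S := by exact_mod_cast hS
      have hden : (0 : ℝ) < B.den := by exact_mod_cast B.den_pos
      have h2 : (I.absHi : ℝ) * B.den ≤ B.num * S := by exact_mod_cast h
      have hB : (B : ℝ) = B.num / B.den := by exact_mod_cast (Rat.num_div_den B).symm
      rw [hB, le_div_iff₀ hden]
      nlinarith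

end Summit.HubbardSuperconductivity.HubbardSuperconductivity.Theorems.FreeBandJets

end
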